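import Literature.NumberTheory.GaloisRepresentations.WeilDeligneRepMonodromyProofs
import Literature.RingTheory.PowerSeries.NilpotentExpLog
import Mathlib.RingTheory.PowerSeries.Log
import Mathlib.RingTheory.PowerSeries.Exp
import Mathlib.RingTheory.PowerSeries.Derivative
import Mathlib.RingTheory.PowerSeries.Inverse
import Mathlib.RingTheory.PowerSeries.Trunc
import Mathlib.RingTheory.Nilpotent.Exp
import Mathlib.RingTheory.IntegralDomain
import Mathlib.RingTheory.RootsOfUnity.Basic
import Mathlib.Algebra.Polynomial.AlgebraMap
import Mathlib.Algebra.Polynomial.Div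
import Mathlib.Algebra.Ring.Action.ConjAct
import Mathlib.FieldTheory.KrullTopology
import Mathlib.Topology.Algebra.OpenSubgroup
import HarnessLib

/-!
# The `ℓ`-adic ↦ Weil–Deligne dictionary: discharge of the named fact
# `Literature.NumberTheory.GaloisRepresentations.exists_weilDeligneRep_of_ladic` (trunk GalRep, item C8)

D-0014 keeps `Literature/` sorry-free by stating cited results as named facts `def X : Prop`.
This sibling file of `Literature.NumberTheory.GaloisRepresentations.WeilDeligneRep` proves the
named fact `exists_weilDeligneRep_of_ladic` (Grothendieck–Deligne: a continuous
`ρ : W_F →ₜ* GL_n(E)`, `E` a non-trivially normed field of characteristic `0` with `‖q‖ = 1`,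
comes from a Weil–Deligne representation `(ρ_WD, N)`: `ρ(u) = exp (t(u) N)` on an open subgroup
of inertia and `ρ_WD(Φ^m u) = ρ(Φ^m u) exp (-t(u) N)`), building on the discharge of
Grothendieck's quasi-unipotence theorem `FramedRep.exists_isOpen_isNilpotent_sub_one_holds`
(`WeilDeligneRepMonodromyProofs.lean`).

## The printed proof (Deligne, Antwerp II, §8.4.2; Tate, Corvallis, (4.2.1); Serre–Tate,
Appendix) and what replaces the tame character `t_ℓ`

Classically `E` is a finite extension of `ℚ_ℓ` (`ℓ ≠ p`), `t = t_ℓ : I_F → ℤ_ℓ(1) ≅ ℤ_ℓ ⊆ E`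
is the `ℓ`-primary tame character, and Grothendieck's argument gives an open subgroup `U` of
`I_F` and a (unique) nilpotent `N` with `ρ(u) = exp (t_ℓ(u) N)` for `u ∈ U`; then
`ρ_WD(Φ^m u) := ρ(Φ^m u) exp (-t_ℓ(u) N)` is a representation trivial on `U` satisfying
`ρ_WD(w) N ρ_WD(w)⁻¹ = q ^ deg w • N` because `t_ℓ(Φ⁻¹ u Φ) = q t_ℓ(u)` for a geometric
Frobenius `Φ`.  The vendored statement allows any non-trivially normed `E` of characteristic `0`
with `‖q‖ = 1` (`ℚ_ℓ^{alg}`, `ℂ_ℓ`, `ℚ` with an `ℓ`-adic norm, `ℚ((T))`, …), where no `t_ℓ` with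
values in `E` need exist; the character `t : I_F → E` is part of the conclusion and is
*constructed from `ρ`*:

1. (**Setup**, from `WeilDeligneRepMonodromyProofs`) `E` is ultrametric; there is an open normal
   subgroup `U = I_F ∩ N'` of `W_F` (`N' ⊴ Γ_F` open normal) on which `ρ` is unipotent, with
   `‖ρ(u) - 1‖ < 1`; by the norm trick `ρ` kills `U ∩ P_F` (`P_F` the wild inertia group), so
   `ρ(U)` is abelian (`I_F/P_F` is abelian) and `ρ(Φ⁻¹ u Φ) = ρ(u)^q` (Frobenius acts on
   `I_F/P_F` by `u ↦ u^q`).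
2. (**Logarithm**, base module `Literature/RingTheory/PowerSeries/NilpotentExpLog`) the truncated logarithm `∑_{k<m} (-1)^(k+1) x^k/k` of a unipotent element `1 + x`
   (`x ^ m = 0`) of a `ℚ`-algebra, with `exp (log (1+x)) = 1 + x`, `log (exp x) = x` (from the power series
   identities `exp ∘ log (1+X) = 1 + X`, `log (1 + (exp X - 1)) = X`, proved by differentiation
   with Mathlib's `PowerSeries.derivative`), hence `L(u) := log ρ(u)` is additive on `U`,
   conjugation-equivariant, kills `U ∩ P_F`, and `L(Φ⁻¹ u Φ) = q L(u)`.
3. (**Tame inertia is procyclic**, the arithmetic input) for every `ε > 0` there are `d` prime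
   to `p` with `{u ∈ U | u fixes ϖ^{1/d}} ⊆ {‖L‖ < ε}` (compactness of `I_F`, `P_F = ⋂_d ker θ_d`)
   and `c ∈ U` with `U = ⋃_k c^k · ker θ_d` (the Kummer character `θ_d` maps `U` onto a finite
   subgroup of `(S/𝔓)ˣ`, which is cyclic); so every `L(u)` is within `ε` of `ℕ L(c)`.
4. (**Rank one**) consequently all `2 × 2` minors `L(u)_{ij} L(v)_{kl} - L(u)_{kl} L(v)_{ij}`
   are arbitrarily small, i.e. zero: the `L(u)`, `u ∈ U`, lie on a line `E · N₀`,
   `L(u) = T(u) N₀`, with `N₀` nilpotent, `ρ(g) N₀ ρ(g)⁻¹ = q ^ deg g • N₀`.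
5. (**The character**) `t(v) := T(v^d)/d` (`d = [Γ_F : N']`, so `v^d ∈ U`) is a homomorphism
   `I_F → E` (additivity from `(vw)^d ≡ v^d w^d` modulo `P_F`) extending `T`, with
   `t(g v g⁻¹) = q ^ deg g • t(v)`.
6. (**Assembly**) `ρ_WD(w) := ρ(w) exp (-t(Φ^{deg w} w) N₀)` is a homomorphism, trivial on `U`,
   with `ρ_WD(w) N₀ = q ^ deg w • N₀ ρ_WD(w)`; `(ρ_WD, N₀)` is the Weil–Deligne representation.

## References

* [Deligne1973Constantes] P. Deligne, *Les constantes des équations fonctionnelles des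
  fonctions `L`*, Antwerp II, LNM 349 (1973), §8.4.2 (= interim key [II1973]).
* [TateCorvallis1979] J. Tate, *Number theoretic background*, Corvallis, Proc. Sympos. Pure
  Math. 33.2 (1979), (4.2.1)–(4.2.3).
* [SerreTate1968GoodReduction] J.-P. Serre, J. Tate, *Good reduction of abelian varieties*,
  Ann. of Math. 88 (1968), Appendix.
* [SerreInventiones1972] J.-P. Serre, Invent. Math. 15 (1972), §1.3 (structure of tame inertia).
-/

noncomputable section

open Polynomial Filter Topology
open scoped Matrix.Norms.Elementwise

namespace Literature.NumberTheory.GaloisRepresentations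

namespace Ladic

open Literature.RingTheory.PowerSeries.NilpotentLog

/-! The truncated logarithm `∑_{k<m} (-1)^(k+1) x^k / k` of a unipotent `1 + x` (`x ^ m = 0`) and its
exp/log dictionary (`exp_logSum`, `logSum_exp_sub_one`, `logSum_mul_of_commute`, `commute_logSum`,
`smul_logSum`, …; formerly sections `Transfer` / `PowerSeriesIdentities` / `Log` of this file) now live
in the Mathlib-only base module `Literature/RingTheory/PowerSeries/NilpotentExpLog`
(namespace `Literature.RingTheory.PowerSeries.NilpotentLog`, opened above). -/

/-! ### Matrices: nilpotents of bounded index; an approximation lemma for rank one -/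

section MatrixLemmas

/-- A nilpotent `n × n` matrix over a field satisfies `A ^ n = 0` (Cayley–Hamilton).
[folklore] -/
theorem pow_eq_zero_of_isNilpotent {K : Type*} [Field K] {n : ℕ} {A : Matrix (Fin n) (Fin n) K}
    (hA : IsNilpotent A) : A ^ n = 0 := by
  have hcp : A.charpoly = Polynomial.X ^ n := by
    rw [← sub_eq_zero]
    have := (Matrix.isNilpotent_charpoly_sub_pow_of_isNilpotent hA).eq_zero
    rwa [Fintype.card_fin] at this
  have h := Matrix.aeval_self_charpoly A
  rwa [hcp, map_pow, aeval_X] at h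

variable {E : Type*} [NormedField E] [IsUltrametricDist E] {ι : Type*} [Fintype ι]

/-- **Rank-one lemma.**  Let `L : S → M_ι(E)` (over an ultrametric field) be bounded and such
that for every `ε > 0` some `L c` approximates every `L s` by a natural multiple up to `ε`:
`‖L s - k • L c‖ < ε`.  Then all `2 × 2` minors of pairs `(L s, L t)` vanish, i.e. the `L s` are
pairwise proportional (the minors are `O(ε)` for every `ε`, the integers `k` having norm `≤ 1`).
[folklore] -/
theorem entry_mul_entry_comm_of_approx {S : Type*} (L : S → Matrix ι ι E) {R : ℝ}
    (hR : ∀ s, ‖L s‖ ≤ R)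
    (happrox : ∀ ε : ℝ, 0 < ε → ∃ c : S, ∀ s : S, ∃ k : ℕ, ‖L s - k • L c‖ < ε)
    (s t : S) (i j i' j' : ι) :
    L s i j * L t i' j' = L s i' j' * L t i j := by
  have hR0 : 0 ≤ R := (norm_nonneg _).trans (hR s)
  set K : ℝ := 2 * (1 + 2 * R) with hK
  have hK0 : 0 < K := by rw [hK]; positivity
  -- the minor is `O(ε)`
  have key : ∀ ε : ℝ, 0 < ε → ε ≤ 1 →
      ‖L s i j * L t i' j' - L s i' j' * L t i j‖ ≤ K * ε := by
    intro ε hε hε1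
    obtain ⟨c, hc⟩ := happrox ε hε
    obtain ⟨k, hk⟩ := hc s
    obtain ⟨m, hm⟩ := hc t
    set α := L s - k • L c with hα
    set β := L t - m • L c with hβ
    set C := L c with hC
    have hs' : L s = α + k • C := by rw [hα, sub_add_cancel]
    have ht' : L t = β + m • C := by rw [hβ, sub_add_cancel]
    have hexp : L s i j * L t i' j' - L s i' j' * L t i j =
        (α i j * β i' j' - α i' j' * β i j) + (m : E) * (α i j * C i' j' - α i' j' * C i j) +
          (k : E) * (C i j * β i' j' - C i' j' * β i j) := by
      rw [hs', ht']
      simp only [Matrix.add_apply, Matrix.smul_apply, nsmul_eq_mul]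
      ring
    have hαe : ∀ a b, ‖α a b‖ ≤ ε := fun a b =>
      (Matrix.norm_entry_le_entrywise_sup_norm α).trans hk.le
    have hβe : ∀ a b, ‖β a b‖ ≤ ε := fun a b =>
      (Matrix.norm_entry_le_entrywise_sup_norm β).trans hm.le
    have hCe : ∀ a b, ‖C a b‖ ≤ R := fun a b =>
      (Matrix.norm_entry_le_entrywise_sup_norm C).trans (hR c)
    have hkE : ‖(k : E)‖ ≤ 1 := IsUltrametricDist.norm_natCast_le_one E k
    have hmE : ‖(m : E)‖ ≤ 1 := IsUltrametricDist.norm_natCast_le_one E m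
    have h1 : ‖α i j * β i' j' - α i' j' * β i j‖ ≤ ε * ε + ε * ε := by
      refine (norm_sub_le _ _).trans (add_le_add ?_ ?_) <;> rw [norm_mul] <;>
        exact mul_le_mul (hαe _ _) (hβe _ _) (norm_nonneg _) hε.le
    have h2 : ‖(m : E) * (α i j * C i' j' - α i' j' * C i j)‖ ≤ 1 * (ε * R + ε * R) := by
      rw [norm_mul]
      refine mul_le_mul hmE ((norm_sub_le _ _).trans (add_le_add ?_ ?_)) (norm_nonneg _)
        zero_le_one <;> rw [norm_mul] <;>
        exact mul_le_mul (hαe _ _) (hCe _ _) (norm_nonneg _) hε.le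
    have h3 : ‖(k : E) * (C i j * β i' j' - C i' j' * β i j)‖ ≤ 1 * (R * ε + R * ε) := by
      rw [norm_mul]
      refine mul_le_mul hkE ((norm_sub_le _ _).trans (add_le_add ?_ ?_)) (norm_nonneg _)
        zero_le_one <;> rw [norm_mul] <;>
        exact mul_le_mul (hCe _ _) (hβe _ _) (norm_nonneg _) hR0
    rw [hexp]
    refine (norm_add₃_le.trans (add_le_add (add_le_add h1 h2) h3)).trans ?_
    rw [hK]
    nlinarith
  -- hence it vanishes
  by_contra hne
  have hD : 0 < ‖L s i j * L t i' j' - L s i' j' * L t i j‖ :=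
    norm_pos_iff.mpr (sub_ne_zero.mpr hne)
  set D := ‖L s i j * L t i' j' - L s i' j' * L t i j‖ with hDdef
  have hε : 0 < min 1 (D / (2 * K)) := lt_min one_pos (by positivity)
  have h1 := key _ hε (min_le_left _ _)
  have h2 : K * min 1 (D / (2 * K)) ≤ K * (D / (2 * K)) :=
    mul_le_mul_of_nonneg_left (min_le_right _ _) hK0.le
  have h3 : K * (D / (2 * K)) = D / 2 := by
    field_simp
  linarith

end MatrixLemmas

/-! ### Galois-theoretic input: Kummer characters, wild inertia, compactness -/

section Galois

open Field ValuativeRel GaloisRepresentations.IsNonarchimedeanLocalField WeilGroup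
open scoped Pointwise Valued

variable {F : Type*} [Field F] [ValuativeRel F] [TopologicalSpace F] [IsNonarchimedeanLocalField F]

/-- **The kernel of `θ_d` on `I_F` fixes every `d`-th root of `ϖ`** (`p ∤ d`): if
`θ_d(σ) = 1` in `S ⧸ 𝔓` then `σ(z_d)/z_d` is a `d`-th root of unity `≡ 1 (mod 𝔓)`, hence `= 1`,
and every other root is `ζ z_d` with `ζ ∈ μ_d` fixed by inertia.  (The single-`d` form of
`mem_absWildInertia_of_kummerCharacterQuot_eq_one`.)
Ref: Serre, Invent. Math. 15 (1972), §1.3. [cite: SerreInventiones1972, §1.3] -/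
theorem smul_eq_self_of_kummerCharacterQuot_eq_one {ϖ : 𝒪[F]} (hϖ0 : ϖ ≠ 0)
    {σ : absoluteGaloisGroup F} (hσ : σ ∈ absInertia F) {d : ℕ} (hd : 0 < d)
    (hpd : ¬ ringChar 𝓀[F] ∣ d) (h : kummerCharacterQuot F hd hϖ0 ⟨σ, hσ⟩ = 1)
    {z : AlgebraicClosure F} (hz : z ^ d = algebraMap 𝒪[F] (AlgebraicClosure F) ϖ) :
    σ • z = z := by
  have hz₀ := coe_kummerRoot_pow F hd ϖ
  have hz₀0 : (kummerRoot F hd ϖ : AlgebraicClosure F) ≠ 0 := coe_kummerRoot_ne_zero hd hϖ0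
  have hQ : absMaximalIdeal F ≠ ⊤ := (absMaximalIdeal_isMaximal_holds F).ne_top
  have hc1 : kummerCocycleInt F hd hϖ0 σ - 1 ∈ absMaximalIdeal F := by
    rw [← Ideal.Quotient.eq, map_one]
    exact h
  have hc : kummerCocycleInt F hd hϖ0 σ = 1 :=
    eq_one_of_pow_eq_one_of_sub_one_mem hQ hd hpd (kummerCocycleInt_pow hd hϖ0 σ) hc1
  have hfix₀ : σ • (kummerRoot F hd ϖ : AlgebraicClosure F) = kummerRoot F hd ϖ := by
    have := congrArg (fun x : absIntegers 𝒪[F] F => (x : AlgebraicClosure F)) hc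
    simp only [coe_kummerCocycleInt, kummerCocycle, OneMemClass.coe_one] at this
    exact (div_eq_one_iff_eq hz₀0).mp this
  have hϖ' : algebraMap 𝒪[F] (AlgebraicClosure F) ϖ ≠ 0 := by
    rw [← hz₀]; exact pow_ne_zero _ hz₀0
  set ζ := z / kummerRoot F hd ϖ with hζ
  have hζd : ζ ^ d = 1 := by rw [hζ, div_pow, hz, hz₀, div_self hϖ']
  have hzζ : z = ζ * kummerRoot F hd ϖ := by rw [hζ, div_mul_cancel₀ _ hz₀0]
  rw [hzζ, smul_mul', smul_eq_self_of_pow_eq_one_of_mem_absInertia hσ hd hpd hζd, hfix₀]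

/-- **Powers in the abelian tame quotient**: `(σ₁ σ₂)^d ≡ σ₁^d σ₂^d (mod P_F)` for
`σ₁, σ₂ ∈ I_F` (every `θ_d` is a homomorphism to the commutative group `(S ⧸ 𝔓)ˣ`).
Ref: Serre, Invent. Math. 15 (1972), §1.3 (`I_t` is abelian). [cite: SerreInventiones1972, §1.3] -/
theorem mul_pow_mul_inv_mem_absWildInertia {ϖ : 𝒪[F]} (hϖ0 : ϖ ≠ 0)
    {σ₁ σ₂ : absoluteGaloisGroup F} (h₁ : σ₁ ∈ absInertia F) (h₂ : σ₂ ∈ absInertia F) (d : ℕ) :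
    (σ₁ * σ₂) ^ d * (σ₁ ^ d * σ₂ ^ d)⁻¹ ∈ absWildInertia F ϖ := by
  have hx : (σ₁ * σ₂) ^ d * (σ₁ ^ d * σ₂ ^ d)⁻¹ ∈ absInertia F :=
    mul_mem (pow_mem (mul_mem h₁ h₂) _) (inv_mem (mul_mem (pow_mem h₁ _) (pow_mem h₂ _)))
  refine mem_absWildInertia_of_kummerCharacterQuot_eq_one hϖ0 hx fun d' hd' hpd' => ?_
  set θ := (kummerCharacterQuot F hd' hϖ0).toHomUnits with hθ
  have hθv : ∀ x, (θ x : absIntegers 𝒪[F] F ⧸ absMaximalIdeal F) =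
      kummerCharacterQuot F hd' hϖ0 x := fun x => rfl
  have hxe : (⟨(σ₁ * σ₂) ^ d * (σ₁ ^ d * σ₂ ^ d)⁻¹, hx⟩ : absInertia F) =
      (⟨σ₁, h₁⟩ * ⟨σ₂, h₂⟩) ^ d *
        ((⟨σ₁, h₁⟩ : absInertia F) ^ d * (⟨σ₂, h₂⟩ : absInertia F) ^ d)⁻¹ := rfl
  have : θ ⟨(σ₁ * σ₂) ^ d * (σ₁ ^ d * σ₂ ^ d)⁻¹, hx⟩ = 1 := by
    rw [hxe, map_mul, map_inv, map_pow, map_mul, map_mul, map_pow, map_pow, mul_inv_eq_one]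
    exact _root_.mul_pow (θ ⟨σ₁, h₁⟩) (θ ⟨σ₂, h₂⟩) d
  rw [← hθv, this, Units.val_one]

/-- **Finite quotients of tame inertia are cyclic** (the form used): for a subgroup `U` of
`I_F ⊆ W_F` and `d` prime to `p`, there is `c ∈ U` such that every `s ∈ U` is congruent to a
power `c^k` modulo the kernel of the Kummer character `θ_d` — `θ_d(U)` is a finite subgroup of
the units of the field `S ⧸ 𝔓`, hence cyclic — so that `s c^{-k}` fixes every `d`-th root of `ϖ`.
Ref: Serre, Invent. Math. 15 (1972), §1.3 (`θ_d : Gal(K_d/K_nr) ≃ μ_d`, `I_t ≃ lim← μ_d`);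
Serre, *Local Fields*, Ch. IV §2, Cor. 1 of Prop. 7. [cite: SerreInventiones1972, §1.3] -/
theorem exists_generator_mod_kummerKer {ϖ : 𝒪[F]} (hϖ0 : ϖ ≠ 0) {d : ℕ} (hd : 0 < d)
    (hpd : ¬ ringChar 𝓀[F] ∣ d) (U : Subgroup (WeilGroup F)) (hU : U ≤ inertia F) :
    ∃ c ∈ U, ∀ s ∈ U, ∃ k : ℕ, ∀ z : AlgebraicClosure F,
      z ^ d = algebraMap 𝒪[F] (AlgebraicClosure F) ϖ →
        toAbsGalois F (s * (c ^ k)⁻¹) • z = z := by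
  classical
  haveI h𝔓 : (absMaximalIdeal F).IsMaximal := absMaximalIdeal_isMaximal_holds F
  haveI : IsDomain (absIntegers 𝒪[F] F ⧸ absMaximalIdeal F) :=
    Ideal.Quotient.isDomain (absMaximalIdeal F)
  -- the Kummer character on `U`, valued in the units of `S ⧸ 𝔓`
  let ι : U →* absInertia F :=
    ((toAbsGalois F).subgroupComap (absInertia F)).comp (Subgroup.inclusion hU)
  let φ : U →* (absIntegers 𝒪[F] F ⧸ absMaximalIdeal F)ˣ :=
    (kummerCharacterQuot F hd hϖ0).toHomUnits.comp ι
  have hφ : ∀ s : U, ((φ s : (absIntegers 𝒪[F] F ⧸ absMaximalIdeal F)ˣ) :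
      absIntegers 𝒪[F] F ⧸ absMaximalIdeal F) =
        kummerCharacterQuot F hd hϖ0 ⟨toAbsGalois F s, hU s.2⟩ := fun s => rfl
  have hφd : ∀ s : U, φ s ^ d = 1 := fun s => by
    apply Units.ext
    rw [Units.val_pow_eq_pow_val, hφ, Units.val_one]
    change Ideal.Quotient.mk _ (kummerCocycleInt F hd hϖ0 _) ^ d = 1
    rw [← map_pow, kummerCocycleInt_pow, map_one]
  -- its image is a finite, hence cyclic, subgroup of the units of a field
  let H : Subgroup (absIntegers 𝒪[F] F ⧸ absMaximalIdeal F)ˣ := φ.range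
  haveI : NeZero d := ⟨hd.ne'⟩
  have hHle : H ≤ rootsOfUnity d (absIntegers 𝒪[F] F ⧸ absMaximalIdeal F) := by
    rintro _ ⟨s, rfl⟩
    rw [mem_rootsOfUnity]
    exact hφd s
  haveI : Finite H := Finite.of_injective _ (Subgroup.inclusion_injective hHle)
  obtain ⟨g, hg⟩ := IsCyclic.exists_generator (α := H)
  obtain ⟨c, hc⟩ := g.2
  refine ⟨c, c.2, fun s hs => ?_⟩
  have hsH : (⟨φ ⟨s, hs⟩, ⟨⟨s, hs⟩, rfl⟩⟩ : H) ∈ Subgroup.zpowers g := hg _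
  rw [← (isOfFinOrder_of_finite g).mem_powers_iff_mem_zpowers] at hsH
  obtain ⟨k, hk⟩ := hsH
  have hk' : (φ c) ^ k = φ ⟨s, hs⟩ := by
    have := congrArg (fun x : H => (x : (absIntegers 𝒪[F] F ⧸ absMaximalIdeal F)ˣ)) hk
    simpa [hc] using this
  refine ⟨k, fun z hz => ?_⟩
  have h1 : φ (⟨s, hs⟩ * (c ^ k)⁻¹) = 1 := by
    rw [map_mul, map_inv, map_pow, hk', mul_inv_cancel]
  have h2 : kummerCharacterQuot F hd hϖ0
      ⟨toAbsGalois F ((⟨s, hs⟩ * (c ^ k)⁻¹ : U) : WeilGroup F), hU ((⟨s, hs⟩ * (c ^ k)⁻¹ : U)).2⟩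
        = 1 := by
    rw [← hφ, h1, Units.val_one]
  exact smul_eq_self_of_kummerCharacterQuot_eq_one hϖ0 _ hd hpd h2 hz

/-- **A single level `d` suffices** (compactness of `I_F`): if every element of a closed
subgroup `U ≤ I_F` mapping to the wild inertia group `P_F = ⋂_{p ∤ d} {fixes ϖ^{1/d}}` lies in
an open set `O`, then already every element of `U` fixing the `d`-th roots of `ϖ`, for one
suitable `d` prime to `p`, lies in `O`.
Ref: Serre, Invent. Math. 15 (1972), §1.3 (`K_t = ⋃_d K_d`); Tate, Corvallis 1979, (1.4.1)
(`I_F` compact). [folklore] -/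
theorem exists_level_of_isOpen {ϖ : 𝒪[F]} (U : Subgroup (WeilGroup F)) (hU : U ≤ inertia F)
    (hUc : IsClosed (U : Set (WeilGroup F))) {O : Set (WeilGroup F)} (hO : IsOpen O)
    (h : ∀ s ∈ U, toAbsGalois F s ∈ absWildInertia F ϖ → s ∈ O) :
    ∃ d : ℕ, 0 < d ∧ ¬ ringChar 𝓀[F] ∣ d ∧ ∀ s ∈ U,
      (∀ z : AlgebraicClosure F, z ^ d = algebraMap 𝒪[F] (AlgebraicClosure F) ϖ →
        toAbsGalois F s • z = z) → s ∈ O := by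
  have hp : (ringChar 𝓀[F]).Prime := ringChar_residueField_prime (F := F)
  let ι := {d : ℕ // 0 < d ∧ ¬ ringChar 𝓀[F] ∣ d}
  haveI : Nonempty ι := ⟨⟨1, one_pos, hp.not_dvd_one⟩⟩
  let C : ι → Set (WeilGroup F) := fun d =>
    {s | s ∈ U ∧ (∀ z : AlgebraicClosure F, z ^ d.1 = algebraMap 𝒪[F] (AlgebraicClosure F) ϖ →
      toAbsGalois F s • z = z) ∧ s ∉ O}
  -- `W_F → Γ_F` is continuous (the preimage of an open `V` is the union of the basic open sets
  -- `B(w, V)`; cf. `WeilGroup.continuous_toAbsGalois'` in `LocalClassFieldTheoryProofs`, not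
  -- imported here to keep local class field theory out of the import graph)
  have hcont : Continuous (toAbsGalois F) := by
    refine continuous_def.mpr fun V hV => ?_
    have h : toAbsGalois F ⁻¹' V =
        ⋃ w : WeilGroup F, {x : WeilGroup F | x * w⁻¹ ∈ inertia F ∧ toAbsGalois F x ∈ V} := by
      ext x
      simp only [Set.mem_preimage, Set.mem_iUnion, Set.mem_setOf_eq]
      exact ⟨fun hx => ⟨x, by simp, hx⟩, fun ⟨_, _, hx⟩ => hx⟩
    rw [h]
    exact isOpen_iUnion fun w => isOpen_basicOpen w hV
  -- the `C d` are closed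
  have hstab : ∀ z : AlgebraicClosure F, IsClosed {s : WeilGroup F | toAbsGalois F s • z = z} := by
    intro z
    have hopen : IsOpen (MulAction.stabilizer (absoluteGaloisGroup F) z : Set (absoluteGaloisGroup F)) :=
      stabilizer_isOpen_of_isIntegral z
    have hcl : IsClosed (MulAction.stabilizer (absoluteGaloisGroup F) z : Set (absoluteGaloisGroup F)) :=
      Subgroup.isClosed_of_isOpen _ hopen
    exact hcl.preimage hcont
  have hC : ∀ d, IsClosed (C d) := by
    intro d
    have h1 : IsClosed (⋂ (z : AlgebraicClosure F)
        (_ : z ^ d.1 = algebraMap 𝒪[F] (AlgebraicClosure F) ϖ),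
        {s : WeilGroup F | toAbsGalois F s • z = z}) :=
      isClosed_iInter fun z => isClosed_iInter fun _ => hstab z
    have heq : C d = (U : Set (WeilGroup F)) ∩ ((⋂ (z : AlgebraicClosure F)
        (_ : z ^ d.1 = algebraMap 𝒪[F] (AlgebraicClosure F) ϖ),
        {s : WeilGroup F | toAbsGalois F s • z = z}) ∩ Oᶜ) := by
      ext s
      simp only [C, Set.mem_setOf_eq, Set.mem_inter_iff, SetLike.mem_coe, Set.mem_iInter,
        Set.mem_compl_iff]
    rw [heq]
    exact hUc.inter (h1.inter hO.isClosed_compl)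
  -- directed
  have hdir : Directed (· ⊇ ·) C := by
    intro a b
    refine ⟨⟨a.1 * b.1, Nat.mul_pos a.2.1 b.2.1, fun hdvd => ?_⟩, ?_, ?_⟩
    · rcases (Nat.Prime.dvd_mul hp).mp hdvd with ha | hb
      · exact a.2.2 ha
      · exact b.2.2 hb
    · rintro s ⟨hsU, hfix, hsO⟩
      refine ⟨hsU, fun z hz => ?_, hsO⟩
      obtain ⟨w, hw⟩ := IsAlgClosed.exists_pow_nat_eq z b.2.1
      have hw' : w ^ (a.1 * b.1) = algebraMap 𝒪[F] (AlgebraicClosure F) ϖ := by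
        rw [mul_comm, pow_mul, hw, hz]
      rw [← hw, smul_pow', hfix w hw']
    · rintro s ⟨hsU, hfix, hsO⟩
      refine ⟨hsU, fun z hz => ?_, hsO⟩
      obtain ⟨w, hw⟩ := IsAlgClosed.exists_pow_nat_eq z a.2.1
      have hw' : w ^ (a.1 * b.1) = algebraMap 𝒪[F] (AlgebraicClosure F) ϖ := by
        rw [pow_mul, hw, hz]
      rw [← hw, smul_pow', hfix w hw']
  -- with empty intersection over inertia
  have hempty : (inertia F : Set (WeilGroup F)) ∩ ⋂ d, C d = ∅ := by
    ext s
    simp only [Set.mem_inter_iff, Set.mem_iInter, Set.mem_empty_iff_false, iff_false, not_and]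
    intro hsI hs
    have hsU : s ∈ U := (hs ⟨1, one_pos, hp.not_dvd_one⟩).1
    have hsO : s ∉ O := (hs ⟨1, one_pos, hp.not_dvd_one⟩).2.2
    apply hsO
    refine h s hsU ⟨mem_inertia_iff.mp hsI, fun d hd hpd z hz => ?_⟩
    exact (hs ⟨d, hd, hpd⟩).2.1 z hz
  obtain ⟨d, hd⟩ := (isCompact_inertia_holds F).elim_directed_family_closed C hC hempty hdir
  refine ⟨d.1, d.2.1, d.2.2, fun s hs hfix => ?_⟩
  by_contra hsO
  have : s ∈ (inertia F : Set (WeilGroup F)) ∩ C d := ⟨hU hs, hs, hfix, hsO⟩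
  rw [hd] at this
  exact this

end Galois

/-! ### The dictionary -/

section Dictionary

open Field ValuativeRel GaloisRepresentations.IsNonarchimedeanLocalField WeilGroup Monodromy
open scoped Pointwise Valued

variable {F : Type*} [Field F] [ValuativeRel F] [TopologicalSpace F] [IsNonarchimedeanLocalField F]
variable {E : Type*} [NontriviallyNormedField E] {n : ℕ}

/-- Commuting with a nilpotent element implies commuting with its exponential. [folklore] -/
theorem commute_exp_of_commute {B : Type*} [Ring B] [Algebra ℚ B] {a b : B} (h : Commute a b)
    (hb : IsNilpotent b) : Commute a (IsNilpotent.exp b) := by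
  obtain ⟨m, hm⟩ := hb
  rw [IsNilpotent.exp_eq_sum hm]
  exact Commute.sum_right _ _ _ fun i _ => (h.pow_right i).smul_right _

/-- Conjugating the exponential of a nilpotent element by a unit: `u⁻¹ exp(A) u = exp(u⁻¹ A u)`
(Mathlib `IsNilpotent.exp_smul` for the conjugation action `ConjAct Bˣ`). [folklore] -/
theorem units_inv_mul_exp_mul {B : Type*} [Ring B] [Algebra ℚ B] (u : Bˣ) {A : B}
    (hA : IsNilpotent A) :
    (↑u⁻¹ : B) * IsNilpotent.exp A * ↑u = IsNilpotent.exp ((↑u⁻¹ : B) * A * ↑u) := by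
  have h := IsNilpotent.exp_smul (ConjAct.toConjAct u⁻¹) hA
  rw [ConjAct.units_smul_def, ConjAct.units_smul_def, ConjAct.ofConjAct_toConjAct, inv_inv] at h
  exact h.symm

/-- **The `ℓ`-adic ↦ Weil–Deligne dictionary** (the content of the named fact
`exists_weilDeligneRep_of_ladic`; see `exists_weilDeligneRep_of_ladic_holds` below and the module
docstring for the proof).
Ref: Deligne, Antwerp II (1973), §8.4.2; Tate, Corvallis 1979, (4.2.1); Serre–Tate, Ann. of
Math. 88 (1968), Appendix. [cite: Deligne1973Constantes, §8.4.2] [cite: TateCorvallis1979, (4.2.1)]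
[cite: SerreTate1968GoodReduction, Appendix] -/
theorem exists_weilDeligneRep [CharZero E] (hq : ‖(residueFieldCard F : E)‖ = 1)
    (ρ : FramedRep (WeilGroup F) E n) :
    ∃ (r : WeilDeligneRep F E (Fin n → E)) (t : WeilGroup.inertia F →* Multiplicative E)
      (U : Subgroup (WeilGroup F)) (Φ : WeilGroup F),
      U ≤ WeilGroup.inertia F ∧ IsOpen (U : Set (WeilGroup F)) ∧ WeilGroup.deg Φ = -1 ∧
      (∀ u : WeilGroup.inertia F, (u : WeilGroup F) ∈ U →
        ((ρ u : GL (Fin n) E) : Matrix (Fin n) (Fin n) E) =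
          IsNilpotent.exp ((t u).toAdd • LinearMap.toMatrix' r.N)) ∧
      (∀ (m : ℤ) (u : WeilGroup.inertia F),
        LinearMap.toMatrix' (r.ρ (Φ ^ m * u)) =
          ((ρ (Φ ^ m * u) : GL (Fin n) E) : Matrix (Fin n) (Fin n) E) *
            IsNilpotent.exp (-((t u).toAdd • LinearMap.toMatrix' r.N))) := by
  classical
  /- ═════════ 0. constants, instances, the matrix-valued homomorphism `M = ρ` ═════════ -/
  have hmul : IsFrobPow.mul (F := F) := IsFrobPow.mul_holds
  have huniq : IsFrobPow.unique (F := F) := IsFrobPow.unique_holds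
  obtain ⟨ϖ, hϖ⟩ := IsDiscreteValuationRing.exists_irreducible 𝒪[F]
  have hϖ0 : ϖ ≠ 0 := hϖ.ne_zero
  have hq2 : 2 ≤ residueFieldCard F := one_lt_residueFieldCard F
  haveI : IsUltrametricDist E := isUltrametricDist_of_norm_natCast_le_one hq2 hq.le
  haveI : IsUltrametricDist (Matrix (Fin n) (Fin n) E) := Pi.instIsUltrametricDist
  have hp : ‖(ringChar 𝓀[F] : E)‖ = 1 := norm_ringChar_eq_one hq
  haveI hIn : (inertia F).Normal := inertia_normal (absInertia_normal_holds F)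
  haveI : IsTopologicalGroup (WeilGroup F) := isTopologicalGroup_holds F
  haveI : CompactSpace (absoluteGaloisGroup F) := absoluteGaloisGroup_compactSpace F
  have hqE : (residueFieldCard F : E) ≠ 0 := by exact_mod_cast residueFieldCard_ne_zero F
  obtain ⟨M, hM, hMc⟩ := exists_monoidHom_matrix ρ
  have hMinv : ∀ w, M w⁻¹ = ((ρ w)⁻¹ : GL (Fin n) E) := fun w => by rw [hM, map_inv]
  -- a geometric Frobenius `Φ` (`deg Φ = -1`); `Φ⁻¹` is an arithmetic Frobenius
  obtain ⟨σΦ, hσΦ⟩ := exists_isFrobPow_holds (F := F) (-1)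
  obtain ⟨Φ, hΦdef⟩ : ∃ Φ : WeilGroup F, Φ = WeilGroup.mk σΦ ⟨-1, hσΦ⟩ := ⟨_, rfl⟩
  have hΦ : deg Φ = -1 := by rw [hΦdef]; exact (deg_eq_iff hmul huniq).mpr hσΦ
  have hΦinv : deg Φ⁻¹ = 1 := by rw [deg_inv hmul huniq, hΦ]; norm_num
  have hτ : IsFrobPow (toAbsGalois F Φ⁻¹) ((1 : ℕ) : ℤ) := by
    rw [Nat.cast_one]; exact (deg_eq_iff hmul huniq).mp hΦinv
  have hdegΦpow : ∀ k : ℤ, deg (Φ ^ k) = -k := fun k => by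
    have h := map_zpow (degHom F hmul huniq) Φ k
    simp only [degHom_apply, hΦ] at h
    have := congrArg Multiplicative.toAdd h
    simpa using this
  have hvI : ∀ g : WeilGroup F, Φ ^ (deg g) * g ∈ inertia F := fun g => by
    rw [← deg_eq_zero_iff_mem_inertia hmul huniq, deg_mul hmul huniq, hdegΦpow]; ring
  have hdecomp : ∀ g : WeilGroup F, g = (Φ ^ deg g)⁻¹ * (Φ ^ deg g * g) := fun g => by group
  /- ═════════ 1. the open normal subgroup `U' = I_F ∩ N'` ═════════ -/
  obtain ⟨UG, -, hUGo, hUGnil⟩ := FramedRep.exists_isOpen_isNilpotent_sub_one_holds hq ρ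
  have hO₁ : IsOpen ({w : WeilGroup F | ‖M w - 1‖ < 1} ∩ (UG : Set (WeilGroup F))) :=
    (isOpen_lt ((hMc.sub continuous_const).norm) continuous_const).inter hUGo
  obtain ⟨V₁, hV₁, hOV₁⟩ := exists_isOpen_inter_inertia_eq hO₁
  have h1V₁ : (1 : absoluteGaloisGroup F) ∈ V₁ := by
    have h1 : (1 : WeilGroup F) ∈ ({w : WeilGroup F | ‖M w - 1‖ < 1} ∩
        (UG : Set (WeilGroup F))) ∩ (inertia F : Set (WeilGroup F)) :=
      ⟨⟨by rw [Set.mem_setOf_eq, map_one, sub_self, norm_zero]; exact one_pos, one_mem _⟩,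
        one_mem _⟩
    rw [hOV₁] at h1
    simpa using h1.2
  obtain ⟨N', hN'V⟩ := ProfiniteGrp.exist_openNormalSubgroup_sub_open_nhds_of_one hV₁ h1V₁
  haveI hN'n : (N' : Subgroup (absoluteGaloisGroup F)).Normal := N'.isNormal'
  let U' : Subgroup (WeilGroup F) :=
    inertia F ⊓ (N' : Subgroup (absoluteGaloisGroup F)).comap (toAbsGalois F)
  have hU'I : U' ≤ inertia F := inf_le_left
  have hU'mem : ∀ {s : WeilGroup F},
      s ∈ U' ↔ s ∈ inertia F ∧ toAbsGalois F s ∈ (N' : Subgroup (absoluteGaloisGroup F)) :=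
    fun {s} => Iff.rfl
  have hU'open : IsOpen (U' : Set (WeilGroup F)) := by
    convert isOpen_basicOpen (1 : WeilGroup F) N'.isOpen using 1
    ext s
    simp only [SetLike.mem_coe, Set.mem_setOf_eq, inv_one, mul_one]
    exact hU'mem
  have hU'closed : IsClosed (U' : Set (WeilGroup F)) := Subgroup.isClosed_of_isOpen _ hU'open
  haveI hU'n : U'.Normal := Subgroup.normal_inf_normal _ _
  have hU'O : ∀ s ∈ U', ‖M s - 1‖ < 1 ∧ s ∈ UG := fun s hs => by
    have : s ∈ ({w : WeilGroup F | ‖M w - 1‖ < 1} ∩ (UG : Set (WeilGroup F))) ∩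
        (inertia F : Set (WeilGroup F)) := by
      rw [hOV₁]
      exact ⟨hs.1, hN'V hs.2⟩
    exact ⟨this.1.1, this.1.2⟩
  have hU'1 : ∀ s ∈ U', ‖M s - 1‖ < 1 := fun s hs => (hU'O s hs).1
  have hU'nil : ∀ s ∈ U', IsNilpotent (M s - 1) := fun s hs => by
    rw [hM]; exact hUGnil s (hU'O s hs).2
  have hU'pow : ∀ s ∈ U', (M s - 1) ^ n = 0 := fun s hs =>
    pow_eq_zero_of_isNilpotent (hU'nil s hs)
  -- the exponent `d = [Γ_F : N']`: `v ^ d ∈ U'` for every `v ∈ I_F`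
  haveI : Finite (absoluteGaloisGroup F ⧸ (N' : Subgroup (absoluteGaloisGroup F))) :=
    Subgroup.quotient_finite_of_isOpen _ N'.isOpen
  obtain ⟨d, hd_def⟩ : ∃ d : ℕ,
      d = Nat.card (absoluteGaloisGroup F ⧸ (N' : Subgroup (absoluteGaloisGroup F))) := ⟨_, rfl⟩
  have hd : 0 < d := by rw [hd_def]; exact Nat.card_pos
  have hdE : (d : E) ≠ 0 := Nat.cast_ne_zero.mpr hd.ne'
  have hpowU : ∀ v ∈ inertia F, v ^ d ∈ U' := fun v hv => by
    have h2 : toAbsGalois F (v ^ d) ∈ (N' : Subgroup (absoluteGaloisGroup F)) := by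
      rw [map_pow, ← QuotientGroup.eq_one_iff, QuotientGroup.mk_pow, hd_def]
      exact pow_card_eq_one'
    exact hU'mem.mpr ⟨pow_mem hv _, h2⟩
  /- ═════════ 2. `ρ` kills `U' ∩ P_F`; `ρ(U')` is abelian; Frobenius relation ═════════ -/
  have hkill : ∀ x ∈ U', toAbsGalois F x ∈ absWildInertia F ϖ → M x = 1 := fun x hx hxP => by
    have := eq_one_of_mem_absWildInertia (absWildInertia_isProP_holds F) hϖ hp ρ (hU'I hx) hxP
      (by rw [← hM]; exact hU'1 x hx)
    rw [hM, this, Units.val_one]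
  have hMeq : ∀ x ∈ U', ∀ y ∈ U', toAbsGalois F (x * y⁻¹) ∈ absWildInertia F ϖ → M x = M y :=
    fun x hx y hy hP => by
    have h1 := hkill _ (mul_mem hx (inv_mem hy)) hP
    rw [map_mul, hMinv, hM, Units.mul_inv_eq_one] at h1
    rw [hM, hM, h1]
  have hcomm : ∀ s ∈ U', ∀ t ∈ U', Commute (M s) (M t) := by
    intro s hs t ht
    have hc : s * t * s⁻¹ * t⁻¹ ∈ U' :=
      mul_mem (mul_mem (mul_mem hs ht) (inv_mem hs)) (inv_mem ht)
    have hcP : toAbsGalois F (s * t * s⁻¹ * t⁻¹) ∈ absWildInertia F ϖ := by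
      simpa only [map_mul, map_inv] using
        commutator_mem_absWildInertia hϖ0 (hU'I hs) (hU'I ht)
    have h1 := hkill _ hc hcP
    rw [hM, ← Units.val_one, Units.val_injective.eq_iff, map_mul, map_mul, map_mul, map_inv,
      map_inv, ← commutatorElement_def, commutatorElement_eq_one_iff_mul_comm] at h1
    rw [hM, hM]
    exact Commute.units_val h1
  have hFrobM : ∀ s ∈ U', M (Φ⁻¹ * s * Φ) = M s ^ residueFieldCard F := by
    intro s hs
    have hconj : Φ⁻¹ * s * Φ⁻¹⁻¹ ∈ U' := hU'n.conj_mem s hs Φ⁻¹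
    have hxP : toAbsGalois F (Φ⁻¹ * s * Φ⁻¹⁻¹ * (s ^ residueFieldCard F)⁻¹) ∈
        absWildInertia F ϖ := by
      have := conj_mul_pow_inv_mem_absWildInertia (ϖ := ϖ) hϖ0 hτ (hU'I hs)
      simpa only [map_mul, map_inv, map_pow, pow_one, inv_inv] using this
    have h1 := hMeq _ hconj _ (pow_mem hs _) hxP
    rwa [inv_inv, map_pow] at h1
  /- ═════════ 3. the logarithm `L = log ρ` on `U'` ═════════ -/
  obtain ⟨L, hLdef⟩ : ∃ L : WeilGroup F → Matrix (Fin n) (Fin n) E, ∀ w,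
      L w = ∑ k ∈ Finset.range n, (((((-1 : ℚ) ^ (k + 1)) / k : ℚ) : E)) • (M w - 1) ^ k :=
    ⟨_, fun _ => rfl⟩
  have hLc : Continuous L := by
    have : L = fun w => ∑ k ∈ Finset.range n,
        (((((-1 : ℚ) ^ (k + 1)) / k : ℚ) : E)) • (M w - 1) ^ k := funext hLdef
    rw [this]
    refine continuous_finsetSum _ fun k _ => ?_
    have hk : Continuous fun a => (M a - 1) ^ k := (hMc.sub continuous_const).pow k
    exact hk.const_smul (((((-1 : ℚ) ^ (k + 1)) / k : ℚ) : E))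
  have hLM : ∀ w w', M w = M w' → L w = L w' := fun w w' h => by rw [hLdef, hLdef, h]
  have hLQ : ∀ w, L w = ∑ k ∈ Finset.range n, (((-1 : ℚ) ^ (k + 1)) / k) • (M w - 1) ^ k :=
    fun w => by
    rw [hLdef]
    exact Finset.sum_congr rfl fun k _ => Rat.cast_smul_eq_qsmul E _ _
  have hexpL : ∀ s ∈ U', IsNilpotent.exp (L s) = M s := fun s hs => by
    rw [hLQ, exp_logSum (hU'pow s hs), add_sub_cancel]
  have hL1 : ∀ x ∈ U', M x = 1 → L x = 0 := fun x hx h1 => by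
    rw [hLQ, h1, sub_self, logSum_zero]
  have hLone : L 1 = 0 := hL1 1 (one_mem _) (map_one M)
  have hLn : ∀ s ∈ U', L s ^ n = 0 := fun s hs => by
    rw [hLQ]; exact logSum_pow_eq_zero (hU'pow s hs)
  have hLmul : ∀ s ∈ U', ∀ t ∈ U', L (s * t) = L s + L t := fun s hs t ht => by
    have hc1 : Commute (M s - 1) (M t - 1) :=
      ((hcomm s hs t ht).sub_right (Commute.one_right _)).sub_left (Commute.one_left _)
    have hsum : (L s + L t) ^ n = 0 := by
      refine pow_eq_zero_of_isNilpotent (Commute.isNilpotent_add ?_ ⟨n, hLn s hs⟩ ⟨n, hLn t ht⟩)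
      rw [hLQ, hLQ]
      exact commute_logSum hc1 n n
    rw [hLQ, hLQ] at hsum
    rw [hLQ, hLQ, hLQ, map_mul, ← logSum_mul_of_commute hc1 (hU'pow s hs) (hU'pow t ht) hsum]
    congr 1; noncomm_ring
  have hLinv : ∀ s ∈ U', L s⁻¹ = -L s := fun s hs => by
    have := hLmul s⁻¹ (inv_mem hs) s hs
    rw [inv_mul_cancel, hLone] at this
    exact eq_neg_of_add_eq_zero_left this.symm
  have hLpow : ∀ s ∈ U', ∀ k : ℕ, L (s ^ k) = k • L s := fun s hs k => by
    induction k with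
    | zero => rw [pow_zero, hLone, zero_smul]
    | succ k ih => rw [pow_succ, hLmul _ (pow_mem hs k) s hs, ih, succ_nsmul]
  have hLP : ∀ x ∈ U', ∀ y ∈ U', toAbsGalois F (x * y⁻¹) ∈ absWildInertia F ϖ → L x = L y :=
    fun x hx y hy hP => hLM _ _ (hMeq x hx y hy hP)
  have hLnil : ∀ s ∈ U', IsNilpotent (L s) := fun s hs => ⟨n, hLn s hs⟩
  -- conjugation: `L (g s g⁻¹) = ρ(g) L(s) ρ(g)⁻¹`
  have hLconj : ∀ (g : WeilGroup F), ∀ s ∈ U',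
      L (g * s * g⁻¹) = M g * L s * M g⁻¹ := fun g s hs => by
    rw [hLQ, hLQ]
    have hsm : M (g * s * g⁻¹) - 1 = (ConjAct.toConjAct (ρ g)) • (M s - 1) := by
      rw [ConjAct.units_smul_def, ConjAct.ofConjAct_toConjAct, map_mul, map_mul, hMinv g, hM g,
        mul_sub, sub_mul, mul_one, Units.mul_inv]
    rw [hsm, ← smul_logSum, ConjAct.units_smul_def, ConjAct.ofConjAct_toConjAct, hMinv g, hM g]
  -- Frobenius: `L (Φ⁻¹ s Φ) = q L(s)`
  have hLfrob : ∀ s ∈ U', L (Φ⁻¹ * s * Φ) = (residueFieldCard F : E) • L s := fun s hs => by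
    have h := hFrobM s hs
    rw [← map_pow] at h
    rw [hLM _ _ h, hLpow s hs, Nat.cast_smul_eq_nsmul]
  /- ═════════ 4. rank one: the `L(s)`, `s ∈ U'`, are pairwise proportional ═════════ -/
  have happroxU : ∀ ε : ℝ, 0 < ε → ∃ c ∈ U', ∀ s ∈ U', ∃ k : ℕ, ‖L s - k • L c‖ < ε := by
    intro ε hε
    have hO : IsOpen {w : WeilGroup F | ‖L w‖ < ε} := isOpen_lt hLc.norm continuous_const
    obtain ⟨d₁, hd₁, hpd₁, hlev⟩ := exists_level_of_isOpen (ϖ := ϖ) U' hU'I hU'closed hO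
      (fun s hs hsP => by
        show ‖L s‖ < ε
        rw [hL1 s hs (hkill s hs hsP), norm_zero]; exact hε)
    obtain ⟨c, hcU, hc⟩ := exists_generator_mod_kummerKer hϖ0 hd₁ hpd₁ U' hU'I
    refine ⟨c, hcU, fun s hs => ?_⟩
    obtain ⟨k, hk⟩ := hc s hs
    refine ⟨k, ?_⟩
    have hmem : s * (c ^ k)⁻¹ ∈ U' := mul_mem hs (inv_mem (pow_mem hcU k))
    have h1 : ‖L (s * (c ^ k)⁻¹)‖ < ε := hlev _ hmem hk
    rwa [hLmul s hs _ (inv_mem (pow_mem hcU k)), hLinv _ (pow_mem hcU k), hLpow c hcU,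
      ← sub_eq_add_neg] at h1
  obtain ⟨R, hR⟩ : ∃ R : ℝ, ∀ s ∈ U', ‖L s‖ ≤ R := by
    obtain ⟨R, hR⟩ := (isCompact_inertia_holds F).exists_bound_of_continuousOn hLc.continuousOn
    exact ⟨R, fun s hs => hR s (hU'I hs)⟩
  have hprop : ∀ s ∈ U', ∀ t ∈ U', ∀ i j i' j' : Fin n,
      L s i j * L t i' j' = L s i' j' * L t i j := by
    intro s hs t ht
    exact entry_mul_entry_comm_of_approx (fun u : U' => L u) (R := R) (fun u => hR u u.2)
      (fun ε hε => by
        obtain ⟨c, hcU, hc⟩ := happroxU ε hε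
        exact ⟨⟨c, hcU⟩, fun u => hc u u.2⟩) ⟨s, hs⟩ ⟨t, ht⟩
  /- ═════════ 5. the line `E · N₀` and the scalar function `T` ═════════ -/
  obtain ⟨u₁, hu₁U, hu₁⟩ : ∃ u₁ ∈ U', ∀ s ∈ U', L s ≠ 0 → L u₁ ≠ 0 := by
    by_cases hex0 : ∃ s ∈ U', L s ≠ 0
    · obtain ⟨s, hs, hs0⟩ := hex0
      exact ⟨s, hs, fun _ _ _ => hs0⟩
    · push Not at hex0
      exact ⟨1, one_mem _, fun s hs hs0 => absurd (hex0 s hs) hs0⟩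
  obtain ⟨N₀, hN₀def⟩ : ∃ N₀ : Matrix (Fin n) (Fin n) E, N₀ = L u₁ := ⟨_, rfl⟩
  have hN₀nil : IsNilpotent N₀ := by rw [hN₀def]; exact hLnil u₁ hu₁U
  obtain ⟨T, hTL, hTlin⟩ : ∃ T : WeilGroup F → E, (∀ s ∈ U', L s = T s • N₀) ∧
      (∀ (w : WeilGroup F) (c₁ : E) (w₁ : WeilGroup F) (c₂ : E) (w₂ : WeilGroup F),
        L w = c₁ • L w₁ + c₂ • L w₂ → T w = c₁ * T w₁ + c₂ * T w₂) := by
    by_cases hN : N₀ = 0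
    · refine ⟨fun _ => 0, fun s hs => ?_, fun _ _ _ _ _ _ => by ring⟩
      rw [zero_smul]
      by_contra hs0
      exact hu₁ s hs hs0 (hN₀def ▸ hN)
    · obtain ⟨i, j, hij⟩ : ∃ i j, N₀ i j ≠ 0 := by
        by_contra hall
        push Not at hall
        exact hN (Matrix.ext hall)
      refine ⟨fun w => L w i j / N₀ i j, fun s hs => ?_, fun w c₁ w₁ c₂ w₂ h => ?_⟩
      · ext a b
        dsimp only
        rw [Matrix.smul_apply, smul_eq_mul, div_mul_eq_mul_div, eq_div_iff hij, hN₀def]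
        exact hprop s hs u₁ hu₁U a b i j
      · dsimp only
        rw [h, Matrix.add_apply, Matrix.smul_apply, Matrix.smul_apply, smul_eq_mul, smul_eq_mul]
        ring
  have hT0 : ∀ w, L w = 0 → T w = 0 := fun w h => by
    have := hTlin w 0 w 0 w (by rw [h, zero_smul, add_zero])
    rw [this]; ring
  have hTadd : ∀ w w₁ w₂, L w = L w₁ + L w₂ → T w = T w₁ + T w₂ := fun w w₁ w₂ h => by
    have := hTlin w 1 w₁ 1 w₂ (by rw [h, one_smul, one_smul])
    rw [this]; ring
  have hTsmul : ∀ (w : WeilGroup F) (c : E) (w₁ : WeilGroup F),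
      L w = c • L w₁ → T w = c * T w₁ := fun w c w₁ h => by
    have := hTlin w c w₁ 0 w₁ (by rw [h, zero_smul, add_zero])
    rw [this]; ring
  have hTeq : ∀ w w₁, L w = L w₁ → T w = T w₁ := fun w w₁ h => by
    have := hTsmul w 1 w₁ (by rw [h, one_smul]); rw [this, one_mul]
  have hTone : T 1 = 0 := hT0 1 hLone
  have hTmul : ∀ s ∈ U', ∀ t ∈ U', T (s * t) = T s + T t :=
    fun s hs t ht => hTadd _ _ _ (hLmul s hs t ht)
  have hTpow : ∀ s ∈ U', ∀ k : ℕ, T (s ^ k) = k * T s := fun s hs k =>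
    hTsmul _ _ _ (by rw [hLpow s hs k, Nat.cast_smul_eq_nsmul])
  have hTP : ∀ x ∈ U', ∀ y ∈ U', toAbsGalois F (x * y⁻¹) ∈ absWildInertia F ϖ → T x = T y :=
    fun x hx y hy hP => hTeq _ _ (hLP x hx y hy hP)
  have hexpT : ∀ s ∈ U', M s = IsNilpotent.exp (T s • N₀) := fun s hs => by
    rw [← hTL s hs, hexpL s hs]
  -- `T` on conjugates: `T (g s g⁻¹) = q ^ deg g • T s` (`s ∈ U'`)
  have hTconjI : ∀ g ∈ inertia F, ∀ s ∈ U', T (g * s * g⁻¹) = T s := fun g hg s hs => by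
    refine hTP _ (hU'n.conj_mem s hs g) s hs ?_
    simpa only [map_mul, map_inv] using commutator_mem_absWildInertia hϖ0 hg (hU'I hs)
  have hTfrob : ∀ s ∈ U', T (Φ⁻¹ * s * Φ) = (residueFieldCard F : E) * T s := fun s hs =>
    hTsmul _ _ _ (hLfrob s hs)
  let ST : Subgroup (WeilGroup F) :=
    { carrier := {g | ∀ s ∈ U', T (g * s * g⁻¹) = (residueFieldCard F : E) ^ deg g * T s}
      one_mem' := fun s _ => by
        simp [deg_one hmul huniq]
      mul_mem' := by
        intro g h hg hh s hs
        have hhs : h * s * h⁻¹ ∈ U' := hU'n.conj_mem s hs h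
        calc T (g * h * s * (g * h)⁻¹) = T (g * (h * s * h⁻¹) * g⁻¹) := by
              rw [show g * h * s * (g * h)⁻¹ = g * (h * s * h⁻¹) * g⁻¹ by group]
          _ = (residueFieldCard F : E) ^ deg g * T (h * s * h⁻¹) := hg _ hhs
          _ = (residueFieldCard F : E) ^ deg (g * h) * T s := by
              rw [hh s hs, deg_mul hmul huniq, zpow_add₀ hqE]; ring
      inv_mem' := by
        intro g hg s hs
        have hgs : g⁻¹ * s * g⁻¹⁻¹ ∈ U' := hU'n.conj_mem s hs g⁻¹
        have h1 := hg _ hgs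
        have h2 : g * (g⁻¹ * s * g⁻¹⁻¹) * g⁻¹ = s := by group
        rw [h2] at h1
        rw [deg_inv hmul huniq, zpow_neg, h1, ← mul_assoc, inv_mul_cancel₀ (zpow_ne_zero _ hqE),
          one_mul] }
  have hSTmem : ∀ g, g ∈ ST ↔
      ∀ s ∈ U', T (g * s * g⁻¹) = (residueFieldCard F : E) ^ deg g * T s := fun g => Iff.rfl
  have hSTI : inertia F ≤ ST := fun g hg => (hSTmem g).mpr fun s hs => by
    rw [hTconjI g hg s hs, (deg_eq_zero_iff_mem_inertia hmul huniq).mpr hg, zpow_zero, one_mul]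
  have hSTΦ : Φ ∈ ST := by
    have h : Φ⁻¹ ∈ ST := (hSTmem _).mpr fun s hs => by
      rw [inv_inv, hTfrob s hs, hΦinv, zpow_one]
    simpa using ST.inv_mem h
  have hSTall : ∀ g, g ∈ ST := fun g => by
    rw [hdecomp g]
    exact mul_mem (inv_mem (zpow_mem hSTΦ _)) (hSTI (hvI g))
  have hTconj : ∀ (g : WeilGroup F), ∀ s ∈ U',
      T (g * s * g⁻¹) = (residueFieldCard F : E) ^ deg g * T s :=
    fun g => (hSTmem g).mp (hSTall g)
  /- ═════════ 6. equivariance of `N₀`: `ρ(g) N₀ = q ^ deg g • N₀ ρ(g)` ═════════ -/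
  have hEQ : ∀ g : WeilGroup F,
      M g * N₀ = ((residueFieldCard F : E) ^ deg g) • (N₀ * M g) := by
    intro g
    have hgs : g * u₁ * g⁻¹ ∈ U' := hU'n.conj_mem u₁ hu₁U g
    have h1 : L (g * u₁ * g⁻¹) = M g * N₀ * M g⁻¹ := by rw [hN₀def]; exact hLconj g u₁ hu₁U
    have h2 : L (g * u₁ * g⁻¹) = ((residueFieldCard F : E) ^ deg g) • N₀ := by
      rw [hTL _ hgs, hTconj g u₁ hu₁U]
      by_cases hN : N₀ = 0
      · rw [hN, smul_zero, smul_zero]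
      · have hT1 : T u₁ = 1 := by
          have hLu := hTL u₁ hu₁U
          rw [← hN₀def] at hLu
          obtain ⟨i, j, hij⟩ : ∃ i j, N₀ i j ≠ 0 := by
            by_contra hall; push Not at hall; exact hN (Matrix.ext hall)
          have hij' := congrFun (congrFun hLu i) j
          rw [Matrix.smul_apply, smul_eq_mul] at hij'
          exact (mul_eq_right₀ hij).mp hij'.symm
        rw [hT1, mul_one]
    rw [h1] at h2
    calc M g * N₀ = M g * N₀ * M g⁻¹ * M g := by
          rw [mul_assoc (M g * N₀), ← map_mul, inv_mul_cancel, map_one, mul_one]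
      _ = ((residueFieldCard F : E) ^ deg g) • N₀ * M g := by rw [h2]
      _ = ((residueFieldCard F : E) ^ deg g) • (N₀ * M g) := smul_mul_assoc _ _ _
  have hEQ' : ∀ (g : WeilGroup F) (c : E),
      ((ρ g)⁻¹ : GL (Fin n) E) * (c • N₀) * (ρ g : GL (Fin n) E) =
        (c * (residueFieldCard F : E) ^ (-deg g)) • N₀ := by
    intro g c
    have h := hEQ g⁻¹
    rw [deg_inv hmul huniq, hMinv] at h
    rw [Matrix.mul_smul, Matrix.smul_mul, h, smul_mul_assoc, mul_assoc, Units.inv_mul, mul_one,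
      smul_smul]
  /- ═════════ 7. the character `t(v) = T(v^d)/d` on `I_F` ═════════ -/
  obtain ⟨τ', hτ'⟩ : ∃ τ' : WeilGroup F → E, ∀ w, τ' w = T (w ^ d) / d := ⟨_, fun _ => rfl⟩
  have hτ'U : ∀ u ∈ U', τ' u = T u := fun u hu => by
    rw [hτ', hTpow u hu, mul_div_cancel_left₀ _ hdE]
  have hτ'mul : ∀ v ∈ inertia F, ∀ w ∈ inertia F, τ' (v * w) = τ' v + τ' w := by
    intro v hv w hw
    rw [hτ', hτ', hτ', ← add_div]
    congr 1
    have h1 : T ((v * w) ^ d) = T (v ^ d * w ^ d) := by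
      refine hTP _ (hpowU _ (mul_mem hv hw)) _ (mul_mem (hpowU v hv) (hpowU w hw)) ?_
      simpa only [map_mul, map_inv, map_pow] using
        mul_pow_mul_inv_mem_absWildInertia hϖ0 hv hw d
    rw [h1, hTmul _ (hpowU v hv) _ (hpowU w hw)]
  have hτ'one : τ' 1 = 0 := by rw [hτ', one_pow, hTone, zero_div]
  have hτ'conj : ∀ (g : WeilGroup F), ∀ v ∈ inertia F,
      τ' (g * v * g⁻¹) = (residueFieldCard F : E) ^ deg g * τ' v := fun g v hv => by
    rw [hτ', hτ', conj_pow, hTconj g _ (hpowU v hv), mul_div_assoc]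
  let t : inertia F →* Multiplicative E :=
    { toFun := fun v => Multiplicative.ofAdd (τ' v)
      map_one' := by
        change Multiplicative.ofAdd (τ' 1) = 1
        rw [hτ'one, ofAdd_zero]
      map_mul' := fun v w => by
        change Multiplicative.ofAdd (τ' (v * w)) =
          Multiplicative.ofAdd (τ' v) * Multiplicative.ofAdd (τ' w)
        rw [← ofAdd_add, hτ'mul v v.2 w w.2] }
  have ht_apply : ∀ v : inertia F, (t v).toAdd = τ' v := fun v => rfl
  /- ═════════ 8. the representation `ρ_WD(w) = ρ(w) exp (-t(Φ^{deg w} w) N₀)` ═════════ -/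
  obtain ⟨θf, hθf⟩ : ∃ θf : WeilGroup F → E, ∀ w, θf w = τ' (Φ ^ deg w * w) := ⟨_, fun _ => rfl⟩
  have hθfmul : ∀ w₁ w₂ : WeilGroup F,
      θf (w₁ * w₂) = (residueFieldCard F : E) ^ (-deg w₂) * θf w₁ + θf w₂ := by
    intro w₁ w₂
    rw [hθf, hθf, hθf]
    have hgrp : Φ ^ deg (w₁ * w₂) * (w₁ * w₂) =
        (Φ ^ deg w₂ * (Φ ^ deg w₁ * w₁) * (Φ ^ deg w₂)⁻¹) * (Φ ^ deg w₂ * w₂) := by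
      rw [deg_mul hmul huniq]; group
    rw [hgrp, hτ'mul _ (hIn.conj_mem _ (hvI w₁) _) _ (hvI w₂), hτ'conj _ _ (hvI w₁), hdegΦpow]
  have hθfU : ∀ u ∈ U', θf u = T u := fun u hu => by
    rw [hθf, (deg_eq_zero_iff_mem_inertia hmul huniq).mpr (hU'I hu), zpow_zero, one_mul,
      hτ'U u hu]
  -- the correction factor `X c = exp (-c N₀)`
  obtain ⟨X, hX⟩ : ∃ X : E → Matrix (Fin n) (Fin n) E, ∀ c, X c = IsNilpotent.exp (-(c • N₀)) :=
    ⟨_, fun _ => rfl⟩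
  have hXnil : ∀ c : E, IsNilpotent (-(c • N₀)) := fun c => (hN₀nil.smul c).neg
  have hXmul : ∀ a b : E, X a * X b = X (a + b) := fun a b => by
    rw [hX, hX, hX, ← IsNilpotent.exp_add_of_commute _ (hXnil a) (hXnil b), add_smul, neg_add]
    exact (((Commute.refl N₀).smul_left a).smul_right b).neg_left.neg_right
  have hXconj : ∀ (g : WeilGroup F) (c : E),
      X c * M g = M g * X (c * (residueFieldCard F : E) ^ (-deg g)) := by
    intro g c
    rw [hX, hX, hM g]
    have h := units_inv_mul_exp_mul (ρ g) (hXnil c)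
    have h2 : ((ρ g)⁻¹ : GL (Fin n) E) * (-(c • N₀)) * (ρ g : GL (Fin n) E) =
        -((c * (residueFieldCard F : E) ^ (-deg g)) • N₀) := by
      rw [mul_neg, neg_mul, hEQ' g c]
    rw [h2] at h
    rw [← h, ← mul_assoc, ← mul_assoc, Units.mul_inv, one_mul]
  have hXN : ∀ c : E, Commute N₀ (X c) := fun c => by
    rw [hX]
    exact commute_exp_of_commute ((Commute.refl N₀).smul_right c).neg_right (hXnil c)
  let Rw : WeilGroup F →* Matrix (Fin n) (Fin n) E :=
    { toFun := fun w => M w * X (θf w)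
      map_one' := by
        show M 1 * X (θf 1) = 1
        rw [map_one, one_mul, hX, hθf, deg_one hmul huniq, zpow_zero, one_mul, hτ'one, zero_smul,
          neg_zero, IsNilpotent.exp_zero]
      map_mul' := fun w₁ w₂ => by
        show M (w₁ * w₂) * X (θf (w₁ * w₂)) = M w₁ * X (θf w₁) * (M w₂ * X (θf w₂))
        calc M (w₁ * w₂) * X (θf (w₁ * w₂))
            = M w₁ * M w₂ * X ((residueFieldCard F : E) ^ (-deg w₂) * θf w₁ + θf w₂) := by
              rw [map_mul, hθfmul]
          _ = M w₁ * (M w₂ * (X (θf w₁ * (residueFieldCard F : E) ^ (-deg w₂)) *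
                X (θf w₂))) := by
              rw [hXmul, mul_comm (θf w₁), mul_assoc]
          _ = M w₁ * (X (θf w₁) * M w₂ * X (θf w₂)) := by
              rw [hXconj w₂ (θf w₁), mul_assoc]
          _ = M w₁ * X (θf w₁) * (M w₂ * X (θf w₂)) := by
              simp only [mul_assoc] }
  have hRw : ∀ w, Rw w = M w * X (θf w) := fun w => rfl
  have hRwU : ∀ u ∈ U', Rw u = 1 := fun u hu => by
    rw [hRw, hθfU u hu, hexpT u hu, hX]
    exact IsNilpotent.exp_mul_exp_neg_self (hN₀nil.smul _)
  have hRwN : ∀ w, Rw w * N₀ = ((residueFieldCard F : E) ^ deg w) • (N₀ * Rw w) := fun w => by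
    rw [hRw, mul_assoc, ← (hXN _).eq, ← mul_assoc, hEQ w, smul_mul_assoc, mul_assoc]
  /- ═════════ 9. the Weil–Deligne representation ═════════ -/
  let rρ : Representation E (WeilGroup F) (Fin n → E) :=
    { toFun := fun w => Matrix.toLin' (Rw w)
      map_one' := by
        show Matrix.toLin' (Rw 1) = 1
        rw [map_one, Matrix.toLin'_one]
        rfl
      map_mul' := fun a b => by
        show Matrix.toLin' (Rw (a * b)) = Matrix.toLin' (Rw a) * Matrix.toLin' (Rw b)
        rw [map_mul, Matrix.toLin'_mul]
        rfl }
  have hrρ : ∀ w, rρ w = Matrix.toLin' (Rw w) := fun w => rfl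
  let r : WeilDeligneRep F E (Fin n → E) :=
    { ρ := rρ
      isContinuous := ⟨U', hU'I, hU'open, fun u hu => by
        rw [hrρ, hRwU u hu, Matrix.toLin'_one]; rfl⟩
      N := Matrix.toLin' N₀
      isNilpotent_N := hN₀nil.map Matrix.toLinAlgEquiv'
      conj_N := fun w => by
        rw [hrρ, ← Matrix.toLin'_mul, ← Matrix.toLin'_mul, hRwN w, map_smul] }
  have hrN : LinearMap.toMatrix' r.N = N₀ := LinearMap.toMatrix'_toLin' N₀
  refine ⟨r, t, U', Φ, hU'I, hU'open, hΦ, fun u hu => ?_, fun m u => ?_⟩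
  · -- `ρ(u) = exp (t(u) N)` on `U'`
    rw [hrN, ht_apply, ← hM, hτ'U u hu]
    exact hexpT u hu
  · -- `ρ_WD(Φ^m u) = ρ(Φ^m u) exp (-t(u) N)`
    change LinearMap.toMatrix' (Matrix.toLin' (Rw (Φ ^ m * u))) = _
    rw [LinearMap.toMatrix'_toLin', hrN, ht_apply, ← hM, hRw, hX, hθf]
    have hdeg : deg (Φ ^ m * (u : WeilGroup F)) = -m := by
      rw [deg_mul hmul huniq, hdegΦpow, (deg_eq_zero_iff_mem_inertia hmul huniq).mpr u.2,
        add_zero]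
    have hv : Φ ^ deg (Φ ^ m * (u : WeilGroup F)) * (Φ ^ m * u) = u := by
      rw [hdeg, ← mul_assoc, zpow_neg, inv_mul_cancel, one_mul]
    rw [hv]

end Dictionary

end Ladic

section Discharge

variable {F : Type*} [Field F] [ValuativeRel F] [TopologicalSpace F] [IsNonarchimedeanLocalField F]
  {E : Type*} [NontriviallyNormedField E] {n : ℕ}

/-- **Discharge of `exists_weilDeligneRep_of_ladic` (the `ℓ`-adic ↦ Weil–Deligne dictionary of
Grothendieck–Deligne).**  Let `E` be a non-trivially normed field of characteristic `0` in which
the residue cardinality `q` of `F` has norm `1`, and `ρ : W_F →ₜ* GL_n(E)` a continuous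
representation.  Then there are a Weil–Deligne representation `r = (ρ_WD, N)` on `Fin n → E`,
a homomorphism `t : I_F → E`, an open subgroup `U ≤ I_F` and a geometric Frobenius `Φ` with
`ρ(u) = exp (t(u) N)` on `U` and `ρ_WD(Φ^m u) = ρ(Φ^m u) exp (-t(u) N)` (`m ∈ ℤ`, `u ∈ I_F`).
See the module docstring of this file for the proof (Grothendieck's quasi-unipotence theorem,
the logarithm of `ρ` on an open subgroup of inertia, procyclicity of tame inertia, and the
construction of the character `t` from `ρ`); users holding `(h : exists_weilDeligneRep_of_ladic)`
are fed this theorem.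
Ref: Deligne, *Les constantes des équations fonctionnelles des fonctions L* (Antwerp II, LNM
349, 1973), §8.4.2; Tate, *Number theoretic background* (Corvallis 1979), (4.2.1); Serre–Tate,
*Good reduction of abelian varieties*, Ann. of Math. 88 (1968), Appendix.
[cite: Deligne1973Constantes, §8.4.2] [cite: II1973, §8.4.2] [cite: TateCorvallis1979, (4.2.1)]
[cite: SerreTate1968GoodReduction, Appendix] -/
theorem exists_weilDeligneRep_of_ladic_holds :
    exists_weilDeligneRep_of_ladic (F := F) (E := E) (n := n) :=
  fun hq ρ => Ladic.exists_weilDeligneRep hq ρ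

end Discharge

end Literature.NumberTheory.GaloisRepresentations
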